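import Mathlib
import HarnessLib
import Literature.MathematicalPhysics.QuantumFieldTheory.GaussianCovarianceComparison

/-!
# `|E_{N(0,S₁)} H − E_{N(0,S₀)} H| ≤ C δ ‖H‖_{L^p(N(0,S₀))}` for close positive definite covariances
# ([Buc16] Thm 4.5 / [ABKM19] Thm 6.2, crude finite-dimensional core)

Continuation of `GaussianCovarianceComparison.lean` (density ratio `gaussRatio`, change of measure,
`χ²` exponential moments).  For positive definite `S₀, S₁` with `|vᵀ(S₀⁻¹ − S₁⁻¹)v| ≤ δ·vᵀS₀⁻¹v`,
Hölder conjugates `p, q`, `0 ≤ δ ≤ 1/(16q)` and `H ∈ L^p(N(0,S₀))`: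

* **`abs_integral_multivariateGaussian_sub_le`** —
  `|∫ H dN(0,S₁) − ∫ H dN(0,S₀)| ≤ gaussCompConst |ι| q · δ · (∫ |H|^p dN(0,S₀))^{1/p}`,
  `gaussCompConst n q = 8q (e^{3n/16} (√((13/16)^n))⁻¹)^{1/q}` (dimension-dependent: the source's
  volume-independence, via the localisation of the finite-range decomposition, is not attempted — the
  Brouwer form of the fine tuning, `RGFlow.exists_isTunedQ_initial_eq_of_finiteDimensional`, does not need it).

Proof: `dN(0,S₁) = r·dN(0,S₀)` with `r = e^{Z}`, `|Z| ≤ δ(n + ½yᵀS₀⁻¹y)` (the normalising constant is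
pinned by `E r = 1` between the `χ²` moments `(1∓δ)^{−n/2}`), `|r − 1| ≤ |Z|e^{|Z|} ≤ 8qδ·e^{3(n+½yᵀS₀⁻¹y)/(16q)}`,
whose `q`-th power has the explicit Gaussian integral `(8qδ)^q e^{3n/16}(13/16)^{−n/2}`, and Hölder.
Everything is proved; no named fact.

## References
* S. Buchholz, J. Funct. Anal. 275 (2018), Thm 4.5 and its proof [Buchholz2016].
* S. Adams, S. Buchholz, R. Kotecký, S. Müller, arXiv:1910.13564, Theorem 6.2 [AdamsBuchholzKoteckyMuller2019].
-/

noncomputable section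

namespace Literature.MathematicalPhysics.QuantumFieldTheory

open MeasureTheory ProbabilityTheory Matrix WithLp GaussianToolkit
open scoped ENNReal NNReal MatrixOrder

variable {ι : Type*} [Fintype ι] [DecidableEq ι]

/-! ## The comparison estimate -/

/-- The constant of `abs_integral_multivariateGaussian_sub_le`: `8q (e^{3n/16} (√((13/16)^n))⁻¹)^{1/q}`.
[cite: Buchholz2016, Thm 4.5] -/
def gaussCompConst (n : ℕ) (q : ℝ) : ℝ :=
  8 * q * (Real.exp (3 * n / 16) * (Real.sqrt ((13 / 16 : ℝ) ^ n))⁻¹) ^ (1 / q)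

omit [Fintype ι] [DecidableEq ι] in
/-- The constant is non-negative for `q ≥ 0`. [cite: Buchholz2016, Thm 4.5] -/
theorem gaussCompConst_nonneg (n : ℕ) {q : ℝ} (hq : 0 ≤ q) : 0 ≤ gaussCompConst n q := by
  unfold gaussCompConst
  have : 0 ≤ Real.exp (3 * n / 16) * (Real.sqrt ((13 / 16 : ℝ) ^ n))⁻¹ := by positivity
  positivity

/-- **Two close non-degenerate centred Gaussians have close expectations of `L^p` functionals**
(the crude core of [Buc16] Thm 4.5 / [ABKM19] Thm 6.2, dimension-dependent constant).  Let `S₀, S₁` be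
positive definite with `|vᵀ(S₀⁻¹ − S₁⁻¹)v| ≤ δ · vᵀS₀⁻¹v` for all `v`, `p, q` Hölder conjugate, `0 ≤ δ ≤ 1/(16q)`,
and `H ∈ L^p(N(0,S₀))`.  Then
`|∫ H dN(0,S₁) − ∫ H dN(0,S₀)| ≤ gaussCompConst |ι| q · δ · (∫ |H|^p dN(0,S₀))^{1/p}`.
Proof: `dN(0,S₁) = r dN(0,S₀)`, `r = e^{Z}`, `|Z| ≤ δ(n + ½yᵀS₀⁻¹y)`, `|r − 1| ≤ |Z|e^{|Z|}`, Hölder, and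
the `χ²` exponential moment `E e^{½t·yᵀS₀⁻¹y} = (1−t)^{−n/2}`. [cite: Buchholz2016, Thm 4.5] -/
theorem abs_integral_multivariateGaussian_sub_le {S₀ S₁ : Matrix ι ι ℝ} (hS₀ : S₀.PosDef)
    (hS₁ : S₁.PosDef) {δ : ℝ} (hδ0 : 0 ≤ δ)
    (hsand : ∀ v : ι → ℝ, |v ⬝ᵥ (S₀⁻¹ - S₁⁻¹) *ᵥ v| ≤ δ * (v ⬝ᵥ S₀⁻¹ *ᵥ v))
    {p q : ℝ} (hpq : p.HolderConjugate q) (hδq : δ ≤ 1 / (16 * q))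
    {H : EuclideanSpace ℝ ι → ℝ} (hH : MemLp H (ENNReal.ofReal p) (multivariateGaussian 0 S₀)) :
    |∫ y, H y ∂(multivariateGaussian 0 S₁) - ∫ y, H y ∂(multivariateGaussian 0 S₀)| ≤
      gaussCompConst (Fintype.card ι) q * δ *
        (∫ y, |H y| ^ p ∂(multivariateGaussian 0 S₀)) ^ (1 / p) := by
  set μ := multivariateGaussian 0 S₀ with hμ
  set n := Fintype.card ι with hn
  have hp1 : 1 < p := hpq.lt
  have hq1 : 1 < q := hpq.symm.lt
  have hq0 : 0 < q := by linarith
  have hδq' : δ * q ≤ 1 / 16 := by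
    rw [le_div_iff₀ (by positivity)] at hδq
    linarith
  have hδhalf : δ ≤ 1 / 2 := by
    have : δ ≤ 1 / (16 * q) := hδq
    calc δ ≤ 1 / (16 * q) := this
      _ ≤ 1 / 16 := by
          apply div_le_div_of_nonneg_left (by norm_num) (by norm_num)
          linarith
      _ ≤ 1 / 2 := by norm_num
  have hδ1 : δ < 1 := by linarith
  -- the precision form `w(y) = yᵀS₀⁻¹y ≥ 0` and the perturbation `u(y) = yᵀ(S₀⁻¹ − S₁⁻¹)y`
  set P : Matrix ι ι ℝ := S₀⁻¹ with hP
  have hPpd : P.PosDef := hS₀.inv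
  set w : EuclideanSpace ℝ ι → ℝ := fun y => ofLp y ⬝ᵥ P *ᵥ ofLp y with hw
  set u : EuclideanSpace ℝ ι → ℝ := fun y => ofLp y ⬝ᵥ (S₀⁻¹ - S₁⁻¹) *ᵥ ofLp y with hu
  have hw0 : ∀ y, 0 ≤ w y := fun y => by
    have h := hPpd.posSemidef.dotProduct_mulVec_nonneg (ofLp y)
    simpa using h
  have huw : ∀ y, |u y| ≤ δ * w y := fun y => hsand (ofLp y)
  -- the density ratio `r = κ e^{u/2}` and `κ`
  set κ : ℝ := (gaussZ S₀⁻¹ * (gaussZ S₁⁻¹)⁻¹).toReal with hκ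
  have hr : ∀ y, (gaussRatio S₀ S₁ y).toReal = κ * Real.exp (u y / 2) := fun y => toReal_gaussRatio y
  -- `κ ∫ e^{u/2} dμ = 1`
  have hint_r : ∫ y, κ * Real.exp (u y / 2) ∂μ = 1 := by
    have := integral_gaussRatio hS₀ hS₁
    simp_rw [hr] at this
    exact this
  -- exponential moments of `w`: `E e^{½ t w} = (√((1−t)^n))⁻¹`
  have hmom : ∀ t : ℝ, t < 1 → ∫ y, Real.exp (t / 2 * w y) ∂μ = (Real.sqrt ((1 - t) ^ n))⁻¹ := by
    intro t ht
    have h := integral_exp_half_smul_quadForm_precision hS₀ ht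
    have hfun : ∀ y : EuclideanSpace ℝ ι, Real.exp ((1/2 : ℝ) * (ofLp y ⬝ᵥ (t • S₀⁻¹) *ᵥ ofLp y)) =
        Real.exp (t / 2 * w y) := by
      intro y
      rw [Matrix.smul_mulVec, dotProduct_smul, smul_eq_mul]
      congr 1
      simp only [hw]
      ring
    simp_rw [hfun] at h
    exact h
  have hmom_int : ∀ t : ℝ, t < 1 → Integrable (fun y => Real.exp (t / 2 * w y)) μ := by
    intro t ht
    have h := integrable_exp_half_smul_quadForm_precision hS₀ ht
    refine h.congr (Filter.Eventually.of_forall fun y => ?_)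
    show Real.exp ((1/2 : ℝ) * (ofLp y ⬝ᵥ (t • S₀⁻¹) *ᵥ ofLp y)) = Real.exp (t / 2 * w y)
    rw [Matrix.smul_mulVec, dotProduct_smul, smul_eq_mul]
    congr 1
    simp only [hw]
    ring
  -- bounds on `κ`: `(1−δ)^{n/2} ≤ κ ≤ (1+δ)^{n/2}` from `e^{−δw/2} ≤ e^{u/2} ≤ e^{δw/2}`
  have hκ0 : 0 ≤ κ := ENNReal.toReal_nonneg
  have hexp_int : Integrable (fun y => κ * Real.exp (u y / 2)) μ := by
    by_contra hni
    rw [integral_undef hni] at hint_r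
    exact zero_ne_one hint_r
  have hκpos : 0 < κ := by
    rcases hκ0.eq_or_lt with h0 | h0
    · exfalso
      rw [← h0] at hint_r
      simp at hint_r
    · exact h0
  have hI_le : ∫ y, Real.exp (u y / 2) ∂μ ≤ (Real.sqrt ((1 - δ) ^ n))⁻¹ := by
    rw [← hmom δ hδ1]
    refine integral_mono_of_nonneg (Filter.Eventually.of_forall fun y => (Real.exp_pos _).le)
      (hmom_int δ hδ1) (Filter.Eventually.of_forall fun y => ?_)
    refine Real.exp_le_exp.2 ?_
    have := (abs_le.1 (huw y)).2
    linarith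
  have hI_ge : (Real.sqrt ((1 + δ) ^ n))⁻¹ ≤ ∫ y, Real.exp (u y / 2) ∂μ := by
    have hm := hmom (-δ) (by linarith)
    rw [show (1 : ℝ) - -δ = 1 + δ by ring] at hm
    rw [← hm]
    have hint2 : Integrable (fun y => Real.exp (u y / 2)) μ := by
      have := hexp_int.const_mul κ⁻¹
      refine this.congr (Filter.Eventually.of_forall fun y => ?_)
      simp only []
      rw [← mul_assoc, inv_mul_cancel₀ hκpos.ne', one_mul]
    refine integral_mono_of_nonneg (Filter.Eventually.of_forall fun y => (Real.exp_pos _).le)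
      hint2 (Filter.Eventually.of_forall fun y => ?_)
    refine Real.exp_le_exp.2 ?_
    have := (abs_le.1 (huw y)).1
    linarith
  have hκI : κ * ∫ y, Real.exp (u y / 2) ∂μ = 1 := by
    rw [← integral_const_mul]; exact hint_r
  -- `|log κ| ≤ n δ`
  have hlogκ : |Real.log κ| ≤ n * δ := by
    have hIpos : 0 < ∫ y, Real.exp (u y / 2) ∂μ :=
      lt_of_lt_of_le (inv_pos.2 (Real.sqrt_pos.2 (pow_pos (by linarith) _))) hI_ge
    have hκeq : κ = (∫ y, Real.exp (u y / 2) ∂μ)⁻¹ := eq_inv_of_mul_eq_one_left hκI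
    have hs1 : 0 < Real.sqrt ((1 - δ) ^ n) := Real.sqrt_pos.2 (pow_pos (by linarith) _)
    have hs2 : 0 < Real.sqrt ((1 + δ) ^ n) := Real.sqrt_pos.2 (pow_pos (by linarith) _)
    -- `√((1−δ)^n) ≤ κ ≤ √((1+δ)^n)`
    have hκle : κ ≤ Real.sqrt ((1 + δ) ^ n) := by
      rw [hκeq]
      calc (∫ y, Real.exp (u y / 2) ∂μ)⁻¹ ≤ ((Real.sqrt ((1 + δ) ^ n))⁻¹)⁻¹ :=
            inv_anti₀ (inv_pos.2 hs2) hI_ge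
        _ = Real.sqrt ((1 + δ) ^ n) := inv_inv _
    have hκge : Real.sqrt ((1 - δ) ^ n) ≤ κ := by
      rw [hκeq]
      calc Real.sqrt ((1 - δ) ^ n) = ((Real.sqrt ((1 - δ) ^ n))⁻¹)⁻¹ := (inv_inv _).symm
        _ ≤ (∫ y, Real.exp (u y / 2) ∂μ)⁻¹ := inv_anti₀ hIpos hI_le
    rw [abs_le]
    constructor
    · -- `log κ ≥ ½ n log(1−δ) ≥ −nδ`
      have h1 : Real.log (Real.sqrt ((1 - δ) ^ n)) ≤ Real.log κ := Real.log_le_log hs1 hκge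
      have h2 : Real.log (Real.sqrt ((1 - δ) ^ n)) = (n : ℝ) * Real.log (1 - δ) / 2 := by
        rw [Real.log_sqrt (pow_nonneg (by linarith) _), Real.log_pow]
      have h3 := Literature.Analysis.Complex.log_one_sub_ge hδ0 hδhalf
      have hn0 : (0 : ℝ) ≤ n := Nat.cast_nonneg _
      nlinarith
    · have h1 : Real.log κ ≤ Real.log (Real.sqrt ((1 + δ) ^ n)) := Real.log_le_log hκpos hκle
      have h2 : Real.log (Real.sqrt ((1 + δ) ^ n)) = (n : ℝ) * Real.log (1 + δ) / 2 := by
        rw [Real.log_sqrt (pow_nonneg (by linarith) _), Real.log_pow]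
      have h3 : Real.log (1 + δ) ≤ δ := by
        have := Real.log_le_sub_one_of_pos (show (0 : ℝ) < 1 + δ by linarith)
        linarith
      have hn0 : (0 : ℝ) ≤ n := Nat.cast_nonneg _
      nlinarith
  -- pointwise: `|r − 1| ≤ g := 8qδ · e^{3T/(16q)}`, `T = n + w/2`
  set g : EuclideanSpace ℝ ι → ℝ := fun y => 8 * q * δ * Real.exp (3 * (n + w y / 2) / (16 * q)) with hg
  have hg0 : ∀ y, 0 ≤ g y := fun y => by positivity
  have hrg : ∀ y, |(gaussRatio S₀ S₁ y).toReal - 1| ≤ g y := by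
    intro y
    set T := (n : ℝ) + w y / 2 with hT
    have hT0 : 0 ≤ T := by have := hw0 y; positivity
    have hZ : |Real.log κ + u y / 2| ≤ δ * T := by
      have h1 := abs_add_le (Real.log κ) (u y / 2)
      have h2 : |u y / 2| ≤ δ * w y / 2 := by rw [abs_div, abs_two]; linarith [huw y]
      rw [hT]; nlinarith [hlogκ, h1, h2]
    have hreq : (gaussRatio S₀ S₁ y).toReal = Real.exp (Real.log κ + u y / 2) := by
      rw [hr y, Real.exp_add, Real.exp_log hκpos]
    rw [hreq]
    refine (Literature.NumberTheory.Sieve.BombieriSieve.abs_exp_sub_one_le _).trans ?_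
    -- `|Z| e^{|Z|} ≤ δT e^{δT} ≤ (T/(16q)) · 16q ... ` : use `δT ≤ T/(16q)` and `T ≤ 8q e^{T/(8q)}`
    have hδT : δ * T ≤ T / (16 * q) := by
      rw [le_div_iff₀ (by positivity)]
      nlinarith [hδq', hT0]
    have h1 : |Real.log κ + u y / 2| * Real.exp |Real.log κ + u y / 2| ≤ (δ * T) * Real.exp (T / (16 * q)) :=
      mul_le_mul hZ (Real.exp_le_exp.2 (hZ.trans hδT)) (Real.exp_pos _).le (by positivity)
    refine h1.trans ?_
    have h2 : T ≤ 8 * q * Real.exp (T / (8 * q)) := le_mul_exp_div (by positivity) T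
    calc δ * T * Real.exp (T / (16 * q)) ≤ δ * (8 * q * Real.exp (T / (8 * q))) * Real.exp (T / (16 * q)) := by
          gcongr
      _ = 8 * q * δ * Real.exp (3 * T / (16 * q)) := by
          have : Real.exp (T / (8 * q)) * Real.exp (T / (16 * q)) = Real.exp (3 * T / (16 * q)) := by
            rw [← Real.exp_add]; congr 1; field_simp; ring
          calc δ * (8 * q * Real.exp (T / (8 * q))) * Real.exp (T / (16 * q))
              = 8 * q * δ * (Real.exp (T / (8 * q)) * Real.exp (T / (16 * q))) := by ring
            _ = 8 * q * δ * Real.exp (3 * T / (16 * q)) := by rw [this]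
  -- `g^q = (8qδ)^q e^{3n/16} e^{(3/32) w}` is integrable, so `g ∈ L^q`
  have hgq : ∀ y, g y ^ q = (8 * q * δ) ^ q * (Real.exp (3 * n / 16) * Real.exp ((3 / 16) / 2 * w y)) := by
    intro y
    simp only [hg]
    rw [Real.mul_rpow (by positivity) (Real.exp_pos _).le, ← Real.exp_mul, ← Real.exp_add]
    congr 2
    field_simp
  have hgcont : Continuous g := by
    have hc : Continuous fun x : EuclideanSpace ℝ ι => (ofLp x : ι → ℝ) := PiLp.continuous_ofLp 2 _
    have hwc : Continuous w := hc.dotProduct (continuous_const.matrix_mulVec hc)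
    exact continuous_const.mul (Real.continuous_exp.comp ((continuous_const.mul
      (continuous_const.add (hwc.div_const _))).div_const _))
  have hgint : Integrable (fun y => ‖g y‖ ^ q) μ := by
    have h := (hmom_int (3 / 16) (by norm_num)).const_mul ((8 * q * δ) ^ q * Real.exp (3 * n / 16))
    refine h.congr (Filter.Eventually.of_forall fun y => ?_)
    simp only []
    rw [Real.norm_of_nonneg (hg0 y), hgq y]
    ring
  have hqE : ENNReal.ofReal q ≠ 0 := by simp [hq0]
  have hgLq : MemLp g (ENNReal.ofReal q) μ := by
    rw [← integrable_norm_rpow_iff hgcont.aestronglyMeasurable hqE ENNReal.ofReal_ne_top,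
      ENNReal.toReal_ofReal hq0.le]
    exact hgint
  -- `r − 1 ∈ L^q` with `‖r − 1‖_q ≤ ‖g‖_q`
  set ρ : EuclideanSpace ℝ ι → ℝ := fun y => (gaussRatio S₀ S₁ y).toReal - 1 with hρ
  have hρmeas : AEStronglyMeasurable ρ μ := by
    have : Continuous fun y => (gaussRatio S₀ S₁ y).toReal := by
      have h1 : Continuous fun y => κ * Real.exp (u y / 2) :=
        continuous_const.mul (continuous_exp_half_quadForm _)
      exact h1.congr fun y => (hr y).symm
    exact (this.sub continuous_const).aestronglyMeasurable
  have hρLq : MemLp ρ (ENNReal.ofReal q) μ :=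
    hgLq.of_le hρmeas (Filter.Eventually.of_forall fun y => by
      rw [Real.norm_eq_abs, Real.norm_of_nonneg (hg0 y)]; exact hrg y)
  -- the difference of the expectations is `∫ ρ H dμ`
  haveI : ENNReal.HolderConjugate (ENNReal.ofReal p) (ENNReal.ofReal q) :=
    ENNReal.holderConjugate_iff.2 hpq.inv_add_inv_ennreal
  have hρH : Integrable (fun y => ρ y * H y) μ := by
    have h := MemLp.mul' (f := H) (φ := ρ) (r := 1) hH hρLq
    exact memLp_one_iff_integrable.1 h
  have hHint : Integrable H μ := hH.integrable (by
    rw [← ENNReal.ofReal_one]; exact ENNReal.ofReal_le_ofReal hp1.le)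
  have hdiff : ∫ y, H y ∂(multivariateGaussian 0 S₁) - ∫ y, H y ∂μ = ∫ y, ρ y * H y ∂μ := by
    rw [integral_multivariateGaussian_eq_integral_gaussRatio_mul hS₀ hS₁, ← integral_sub _ hHint]
    · refine integral_congr_ae (Filter.Eventually.of_forall fun y => ?_)
      simp only [hρ]; ring
    · have : (fun y => (gaussRatio S₀ S₁ y).toReal * H y) = fun y => ρ y * H y + H y := by
        funext y; simp only [hρ]; ring
      rw [this]
      exact hρH.add hHint
  rw [hdiff]
  -- Hölder
  have hholder := integral_mul_norm_le_Lp_mul_Lq hpq hH hρLq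
  have habs : |∫ y, ρ y * H y ∂μ| ≤ ∫ y, ‖H y‖ * ‖ρ y‖ ∂μ := by
    rw [← Real.norm_eq_abs]
    refine (norm_integral_le_integral_norm _).trans (le_of_eq ?_)
    refine integral_congr_ae (Filter.Eventually.of_forall fun y => ?_)
    simp only [norm_mul]; ring
  refine habs.trans (hholder.trans ?_)
  -- `(∫ |ρ|^q)^{1/q} ≤ gaussCompConst · δ`
  have hρq_le : ∫ y, ‖ρ y‖ ^ q ∂μ ≤ (8 * q * δ) ^ q *
      (Real.exp (3 * n / 16) * (Real.sqrt ((1 - 3 / 16) ^ n))⁻¹) := by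
    calc ∫ y, ‖ρ y‖ ^ q ∂μ ≤ ∫ y, ‖g y‖ ^ q ∂μ := by
          refine integral_mono_of_nonneg (Filter.Eventually.of_forall fun y => by positivity) hgint
            (Filter.Eventually.of_forall fun y => ?_)
          exact Real.rpow_le_rpow (norm_nonneg _)
            (by rw [Real.norm_eq_abs, Real.norm_of_nonneg (hg0 y)]; exact hrg y) hq0.le
      _ = (8 * q * δ) ^ q * (Real.exp (3 * n / 16) * ∫ y, Real.exp ((3 / 16) / 2 * w y) ∂μ) := by
          rw [← integral_const_mul, ← integral_const_mul]
          refine integral_congr_ae (Filter.Eventually.of_forall fun y => ?_)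
          simp only []
          rw [Real.norm_of_nonneg (hg0 y), hgq y]
      _ = _ := by rw [hmom (3 / 16) (by norm_num)]
  have hnum : (1 : ℝ) - 3 / 16 = 13 / 16 := by norm_num
  rw [hnum] at hρq_le
  have hHp0 : 0 ≤ (∫ y, ‖H y‖ ^ p ∂μ) ^ (1 / p) := Real.rpow_nonneg (integral_nonneg fun y => by positivity) _
  have hK0 : 0 ≤ Real.exp (3 * n / 16) * (Real.sqrt ((13 / 16 : ℝ) ^ n))⁻¹ := by positivity
  have hroot : (∫ y, ‖ρ y‖ ^ q ∂μ) ^ (1 / q) ≤ gaussCompConst n q * δ := by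
    calc (∫ y, ‖ρ y‖ ^ q ∂μ) ^ (1 / q)
        ≤ ((8 * q * δ) ^ q * (Real.exp (3 * n / 16) * (Real.sqrt ((13 / 16 : ℝ) ^ n))⁻¹)) ^ (1 / q) :=
          Real.rpow_le_rpow (integral_nonneg fun y => by positivity) hρq_le (by positivity)
      _ = 8 * q * δ * (Real.exp (3 * n / 16) * (Real.sqrt ((13 / 16 : ℝ) ^ n))⁻¹) ^ (1 / q) := by
          rw [Real.mul_rpow (by positivity) hK0, ← Real.rpow_mul (by positivity),
            mul_one_div_cancel hq0.ne', Real.rpow_one]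
          
      _ = gaussCompConst n q * δ := by unfold gaussCompConst; ring
  have hnormH : (∫ y, ‖H y‖ ^ p ∂μ) = ∫ y, |H y| ^ p ∂μ := by
    simp only [Real.norm_eq_abs]
  calc (∫ y, ‖H y‖ ^ p ∂μ) ^ (1 / p) * (∫ y, ‖ρ y‖ ^ q ∂μ) ^ (1 / q)
      ≤ (∫ y, ‖H y‖ ^ p ∂μ) ^ (1 / p) * (gaussCompConst n q * δ) :=
        mul_le_mul_of_nonneg_left hroot hHp0
    _ = gaussCompConst n q * δ * (∫ y, |H y| ^ p ∂μ) ^ (1 / p) := by rw [hnormH]; ring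

end Literature.MathematicalPhysics.QuantumFieldTheory

end
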